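import Literature.IUT.HodgeArakelov.LabelClassesOfCusps
import HarnessLib

/-!
# [IUTchII] Def 2.3 (iv): the labelled decomposition groups `t ↦ Π_{v•t}` — the interface
# `LabelledDecomposition` is INHABITED over every parameter (NV-L6 wave)

S. Mochizuki, *Inter-universal Teichmüller theory II*, §2, Definition 2.3 (iv) (kurims p. 68: "Let
`t ∈ LabCusp^±(Π_v)`. Then `t` determines a unique vertex of `Γ▶_X` … a decomposition group
`Π_{v•t} ⊆ Π_{v▶} ⊆ Π_v` … well-defined up to `Π_{v▶}`-conjugacy") and (v) (p. 69: "one verifies immediately")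
[cite: Mochizuki2012, Def 2.3 (iv) p.68] [claim: Mochizuki2012, status: disputed].

PROOF-ONLY non-vacuity file (abc-iut cell, wave-5 prover abc-iut-w5-d219 gen 2, L6-lead §F v1.18p row call
«NV-L6 WAVE»; interface of `LabelClassesOfCusps.lean`). No `def`/`instance`/`structure` is declared; the
witnesses are built inside the theorem terms.

KERNEL-HONEST CONTENT. The typed record `LabelledDecomposition Dec L` ([IUTchII] Def 2.3 (iv)) carries the
vertex map `t ↦ vertex t` pinned to the chart (`vertex t = L.toFl t`) and the assignment `t ↦ Π_{v•t}`
constrained ONLY by `Π_{v•t} ≤ Π_{v▶}` and `Π_{v•η⁰} = Π_{v•}`. Hence, for EVERY bad-place setting `S`, every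
Prop. 2.1/2.2 datum `(T, D, Dec)`, every `±`-tower `W`, cuspidal-inertia interface `C` and label structure
`L`, the record is inhabited by the CONSTANT assignment `t ↦ Π_{v•}` (admissible since `Π_{v•} ≤ Π_{v▶}` is
the field `SubgraphDecomposition.bullet_le_tri`):

* `LabelledDecomposition.nonempty` — UNIFORM inhabitation (label: uniform/degenerate assignment; it is NOT
  the genuine `t ↦ Π_{v•t}` of the text, which the typed interface does not pin beyond the zero label);
* `LabelledDecomposition.nonempty_of_le` — the same for ANY prescribed family `t ↦ Π_t ≤ Π_{v▶}` agreeing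
  with `Π_{v•}` at `η⁰` (so every genuine assignment, once constructed, is also admitted);
* `def23_structures_iff` — consequently the existence predicate `Def23_structures Dec C` of Def 2.3
  (iii)–(v) REDUCES to `∃ L : LabCuspStructure C, Nonempty (FlTorsorStructure C)`: its
  `LabelledDecomposition` conjunct is automatic.

So the ABSOLUTE inhabitation of `LabelledDecomposition` is exactly that of its parameter records
(`PlusMinusTower`, `CuspidalInertiaData`, `LabCuspStructure` — separate NV-L6 rows; `SubgraphDecomposition`
has `∃`-producers in the tree, e.g. `exists_subgraphDecomposition_trivial`). INFO for the node registry: the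
Def 2.3 (iv) record under-constrains `Pbt` off the zero label (a faithful strengthening would record
`Π_{v•t}` as the decomposition group of the vertex `vertex t` of `Γ▶_X`, [CombGC] Prop. 1.5 (i)).

Nothing here takes a side on [IUTchIII] Cor. 3.12; a non-vacuity witness asserts only that the interface is
consistent; «not yet witnessed» ≠ «vacuous»; typed ≠ proved.
-/

namespace Literature.IUT.HodgeArakelov

universe u

variable {S : BadPlaceSetting.{u}} {P : TopGroup.{u}} {T : TemperedCoverings S P}
  {D : EtaleThetaData S.toThetaSetting P} {W : PlusMinusTower T} {C : CuspidalInertiaData W}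

/-- **Non-vacuity of `LabelledDecomposition`, for ANY prescribed family of subgroups.** Given the Def 2.3
(iii) label structure `L` and any family `Pt : LabCusp^±(Π_v) → Subgroup Π_v` with `Pt t ≤ Π_{v▶}` for all
`t` and `Pt η⁰ = Π_{v•}`, the Def 2.3 (iv) record is inhabited with vertex map the chart `L.toFl` and
`Π_{v•t} := Pt t`. (Every genuine construction of the decomposition groups `Π_{v•t}` of [IUTchII] Def 2.3 (iv)
is admitted through this lemma.) [cite: Mochizuki2012, Def 2.3 (iv) p.68] -/
theorem LabelledDecomposition.nonempty_of_le (Dec : SubgraphDecomposition S T D) (L : LabCuspStructure C)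
    (Pt : LabCuspPM C W.piV W.piPM → Subgroup P) (hle : ∀ t, Pt t ≤ Dec.Ptri)
    (hzero : Pt L.eta0 = Dec.Pbullet) : Nonempty (LabelledDecomposition Dec L) :=
  ⟨{ vertex := L.toFl
     vertex_eq := fun _ => rfl
     Pbt := Pt
     Pbt_le := hle
     Pbt_zero := hzero }⟩

/-- **Non-vacuity of `LabelledDecomposition`, UNIFORM in all parameters** (DEGENERATE assignment: the
constant family `t ↦ Π_{v•}`, admissible because the typed Def 2.3 (iv) record constrains `Π_{v•t}` only by
`Π_{v•t} ≤ Π_{v▶}` — `SubgraphDecomposition.bullet_le_tri` — and `Π_{v•η⁰} = Π_{v•}`). For every bad-place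
setting, every Prop. 2.2 (i) decomposition datum `Dec`, every `±`-tower, cuspidal-inertia interface and
label structure `L`, the record `LabelledDecomposition Dec L` is inhabited.
[cite: Mochizuki2012, Def 2.3 (iv) p.68] -/
theorem LabelledDecomposition.nonempty (Dec : SubgraphDecomposition S T D) (L : LabCuspStructure C) :
    Nonempty (LabelledDecomposition Dec L) :=
  LabelledDecomposition.nonempty_of_le Dec L (fun _ => Dec.Pbullet) (fun _ => Dec.bullet_le_tri) rfl

/-- **Def 2.3 (iii)–(v) existence predicate, reduced.** Since the Def 2.3 (iv) record is inhabited over every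
label structure, `Def23_structures Dec C` ("one verifies immediately", kurims p. 69) is EQUIVALENT to the
existence of a label structure `L : LabCuspStructure C` together with an `𝔽^±_l`-torsor structure
`FlTorsorStructure C`; the labelled-decomposition conjunct carries no extra obligation.
[cite: Mochizuki2012, Def 2.3 (v) p.69] -/
theorem def23_structures_iff (Dec : SubgraphDecomposition S T D) (C : CuspidalInertiaData W) :
    Def23_structures Dec C ↔ ∃ _ : LabCuspStructure C, Nonempty (FlTorsorStructure C) := by
  constructor
  · rintro ⟨L, -, hF⟩
    exact ⟨L, hF⟩
  · rintro ⟨L, hF⟩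
    exact ⟨L, LabelledDecomposition.nonempty Dec L, hF⟩

/-- **Def 2.3 (iii)–(v) existence predicate from its two genuine inputs**: a label structure and an
`𝔽^±_l`-torsor structure on `LabCusp^±(Π̂^±_v)` give `Def23_structures Dec C` for every decomposition datum
`Dec`. [cite: Mochizuki2012, Def 2.3 (v) p.69] -/
theorem def23_structures_of (Dec : SubgraphDecomposition S T D) (L : LabCuspStructure C)
    (F : FlTorsorStructure C) : Def23_structures Dec C :=
  (def23_structures_iff Dec C).mpr ⟨L, ⟨F⟩⟩

end Literature.IUT.HodgeArakelov
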